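import Literature.IUT.HodgeArakelov.KummerStructures
import Literature.IUT.LogThetaLattice.StripCategories

/-!
# Bridge: the two L6 typings of "modulo torsion" agree on commutative groups (C9-a `ModTorsion` canon)

abc-iut cell, layer L6, MERGE-MAP §1 / ruling C9-a (plan/L6/MERGE-MAP.md, abc-iut-L6-t7 INBOX
2026-08-25T19:43:44Z (B2); bridge seat abc-iut-L6-d6). Two L6 statement files type the same printed
notion with different carriers:

* abc-iut-L6-t2, `Literature.IUT.HodgeArakelov.ModTorsion U := U ⧸ CommGroup.torsion U` for a commutative
  GROUP `U` ([IUTchII] Def 4.9 (i), kurims p.154: "`O^{×μ}(A) := O^×(A)/O^μ(A)`"; file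
  `HodgeArakelov/KummerStructures.lean`, p403748), with `UnitsModTorsion O := ModTorsion Oˣ`;
* abc-iut-L6-t3, `Literature.IUT.LogThetaLattice.ModTorsion M := (torsionCon M).Quotient` for a commutative
  MONOID `M`, the quotient by the congruence "`y = ζ · x` for a torsion unit `ζ`" ([IUTchIII] Def 2.4 (i),
  kurims p.88: "`O^▶ := O^⊥/O^μ` … the quotient of `O^⊥` by its torsion subgroup `O^μ`"; file
  `LogThetaLattice/StripCategories.lean`, p404180).

This proof-level companion (no statement file is edited) records that they are ONE notion where both
apply: for a commutative group `U` the congruence `torsionCon U` is the coset relation of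
`CommGroup.torsion U` (`torsionRel_iff_inv_mul_mem_torsion`), whence a canonical isomorphism of monoids
`LogThetaLattice.ModTorsion U ≃* HodgeArakelov.ModTorsion U` commuting with the two quotient maps
(`modTorsionEquiv`, `modTorsionEquiv_mk`); in particular t3's construction applied to the unit group
`Oˣ` of a commutative monoid `O` IS t2's `UnitsModTorsion O` (`unitsModTorsionEquiv`). Moreover the unit
portion embeds: the natural homomorphism `O^{×μ} = Oˣ/O^μ → O^⊥/O^μ = O^▶` induced by `Oˣ → O` is
injective (`unitsModTorsionToModTorsion_injective`) — the inclusion "`O^{×μ} ⊆ O^▶`" implicit in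
[IUTchIII] Def 2.4 (i)/(ii) (the `×μ`-Kummer structures of an `F^{⊢▶×μ}`-prime-strip live on the units of
`O^▶`). Classical group theory; nothing here takes a side on [IUTchIII] Cor 3.12; typed ≠ discharged.
[cite: Mochizuki2012, III Def 2.4 (i) p.88]
-/

namespace Literature.IUT.LogThetaLattice

universe u

section Group

variable (U : Type u) [CommGroup U]

/-- For a unit `u` of a monoid, `u` has finite order iff its value does (restates Mathlib's
`orderOf_units`). [cite: Mochizuki2012, III Def 2.4 (i) p.88] -/
theorem isOfFinOrder_units_val_iff {M : Type u} [Monoid M] (u : Mˣ) :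
    IsOfFinOrder (u : M) ↔ IsOfFinOrder u := by
  rw [← orderOf_pos_iff, ← orderOf_pos_iff, orderOf_units]

/-- On a commutative GROUP, t3's congruence "`y = ζ · x`, `ζ` a torsion unit" ([IUTchIII] Def 2.4 (i))
is the coset relation of the torsion subgroup `U^μ = CommGroup.torsion U` ([IUTchII] Def 4.9 (i)):
`TorsionRel U x y ↔ x⁻¹ * y ∈ CommGroup.torsion U`. [cite: Mochizuki2012, III Def 2.4 (i) p.88] -/
theorem torsionRel_iff_inv_mul_mem_torsion (x y : U) :
    TorsionRel U x y ↔ x⁻¹ * y ∈ CommGroup.torsion U := by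
  rw [CommGroup.mem_torsion]
  constructor
  · rintro ⟨u, hu, rfl⟩
    rw [inv_mul_cancel_comm_assoc]
    exact (isOfFinOrder_units_val_iff u).mpr hu
  · intro h
    refine ⟨toUnits (x⁻¹ * y), ?_, ?_⟩
    · exact (isOfFinOrder_units_val_iff _).mp (by simpa using h)
    · simp [mul_comm x⁻¹ y, inv_mul_cancel_right]

/-- The two quotient maps identify the same pairs: `ModTorsion.mk U x = ModTorsion.mk U y` (t3) iff
`(x : U ⧸ U^μ) = y` (t2). [cite: Mochizuki2012, III Def 2.4 (i) p.88] -/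
theorem modTorsion_mk_eq_iff_quotient_eq (x y : U) :
    ModTorsion.mk U x = ModTorsion.mk U y ↔
      (QuotientGroup.mk x : HodgeArakelov.ModTorsion U) = QuotientGroup.mk y := by
  rw [ModTorsion.mk_eq_mk_iff, QuotientGroup.eq]
  exact torsionRel_iff_inv_mul_mem_torsion U x y

/-- The homomorphism `O^⊥/O^μ → U/U^μ` (t3's quotient to t2's) induced by the identity of `U`, for a
commutative group `U`. [cite: Mochizuki2012, III Def 2.4 (i) p.88] -/
def modTorsionToQuotient : ModTorsion U →* HodgeArakelov.ModTorsion U :=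
  Con.lift (torsionCon U) (QuotientGroup.mk' (CommGroup.torsion U)) (by
    intro x y hxy
    change TorsionRel U x y at hxy
    rw [Con.ker_rel, QuotientGroup.mk'_apply, QuotientGroup.mk'_apply, QuotientGroup.eq]
    exact (torsionRel_iff_inv_mul_mem_torsion U x y).mp hxy)

/-- `modTorsionToQuotient` commutes with the quotient maps. [cite: Mochizuki2012, III Def 2.4 (i) p.88] -/
@[simp] theorem modTorsionToQuotient_mk (x : U) :
    modTorsionToQuotient U (ModTorsion.mk U x) = QuotientGroup.mk x := rfl

/-- `modTorsionToQuotient` is bijective. [cite: Mochizuki2012, III Def 2.4 (i) p.88] -/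
theorem modTorsionToQuotient_bijective : Function.Bijective (modTorsionToQuotient U) := by
  constructor
  · intro a b hab
    obtain ⟨x, rfl⟩ := ModTorsion.mk_surjective U a
    obtain ⟨y, rfl⟩ := ModTorsion.mk_surjective U b
    rw [modTorsionToQuotient_mk, modTorsionToQuotient_mk] at hab
    exact (modTorsion_mk_eq_iff_quotient_eq U x y).mpr hab
  · intro q
    induction q using QuotientGroup.induction_on with
    | H x => exact ⟨ModTorsion.mk U x, rfl⟩

/-- **C9-a bridge.** For a commutative group `U`, t3's `O^⊥/O^μ` ([IUTchIII] Def 2.4 (i)) and t2's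
`U/U^μ` ([IUTchII] Def 4.9 (i)) are canonically isomorphic monoids. [cite: Mochizuki2012, III Def 2.4 (i) p.88] -/
noncomputable def modTorsionEquiv : ModTorsion U ≃* HodgeArakelov.ModTorsion U :=
  MulEquiv.ofBijective (modTorsionToQuotient U) (modTorsionToQuotient_bijective U)

/-- The bridge isomorphism commutes with the two quotient maps `U ↠ O^⊥/O^μ`, `U ↠ U/U^μ`.
[cite: Mochizuki2012, III Def 2.4 (i) p.88] -/
@[simp] theorem modTorsionEquiv_mk (x : U) :
    modTorsionEquiv U (ModTorsion.mk U x) = QuotientGroup.mk x := rfl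

/-- … and so does its inverse. [cite: Mochizuki2012, III Def 2.4 (i) p.88] -/
@[simp] theorem modTorsionEquiv_symm_mk (x : U) :
    (modTorsionEquiv U).symm (QuotientGroup.mk x) = ModTorsion.mk U x := by
  rw [MulEquiv.symm_apply_eq, modTorsionEquiv_mk]

end Group

section Monoid

variable (O : Type u) [CommMonoid O]

/-- **C9-a bridge, unit form.** t3's quotient construction applied to the unit GROUP `Oˣ` of a commutative
monoid `O` is t2's `O^{×μ} := Oˣ/O^μ` (`HodgeArakelov.UnitsModTorsion O`). [cite: Mochizuki2012, III Def 2.4 (i) p.88] -/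
noncomputable def unitsModTorsionEquiv : ModTorsion Oˣ ≃* HodgeArakelov.UnitsModTorsion O :=
  modTorsionEquiv Oˣ

/-- The natural homomorphism `O^{×μ} = Oˣ/O^μ → O^⊥/O^μ = O^▶` induced by the inclusion of units `Oˣ → O`
([IUTchIII] Def 2.4 (i): the unit portion of `O^▶`). [cite: Mochizuki2012, III Def 2.4 (i) p.88] -/
def unitsModTorsionToModTorsion : HodgeArakelov.UnitsModTorsion O →* ModTorsion O :=
  QuotientGroup.lift (CommGroup.torsion Oˣ) ((ModTorsion.mk O).comp (Units.coeHom O)) (by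
    intro u hu
    rw [MonoidHom.mem_ker, MonoidHom.comp_apply, Units.coeHom_apply]
    exact ModTorsion.mk_torsion_unit O u ((CommGroup.mem_torsion _).mp hu))

/-- `unitsModTorsionToModTorsion` on representatives. [cite: Mochizuki2012, III Def 2.4 (i) p.88] -/
@[simp] theorem unitsModTorsionToModTorsion_mk (u : Oˣ) :
    unitsModTorsionToModTorsion O (QuotientGroup.mk u) = ModTorsion.mk O (u : O) := rfl

/-- **`O^{×μ} ↪ O^▶`**: the unit portion of the torsion quotient embeds — two units with the same image in
`O^⊥/O^μ` differ by a torsion unit, hence agree in `Oˣ/O^μ`. [cite: Mochizuki2012, III Def 2.4 (i) p.88] -/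
theorem unitsModTorsionToModTorsion_injective :
    Function.Injective (unitsModTorsionToModTorsion O) := by
  intro a b hab
  induction a using QuotientGroup.induction_on with
  | H u =>
    induction b using QuotientGroup.induction_on with
    | H v =>
      rw [unitsModTorsionToModTorsion_mk, unitsModTorsionToModTorsion_mk, ModTorsion.mk_eq_mk_iff] at hab
      obtain ⟨ζ, hζ, h⟩ := hab
      apply QuotientGroup.eq.mpr
      rw [CommGroup.mem_torsion]
      have hv : v = ζ * u := Units.ext (by rw [Units.val_mul]; exact h)
      rw [hv, inv_mul_cancel_comm_assoc]
      exact hζ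

end Monoid

end Literature.IUT.LogThetaLattice
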